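import Summits.CriticalPhenomena.PercolationContinuityZ3.Theses.PercNearOneGluing
import Literature.Probability.Percolation.PercolationEvents
import HarnessLib.Audit
import Literature.Probability.LatticeModels.ProdBernoulliIndependence
import Literature.Probability.LatticeModels.ProdBernoulliCoupling
import Summits.CriticalPhenomena.PercolationContinuityZ3.Theorems.PercNearOneGluingAdditiveGluingOneBond

/-! TTRL-lite variant V2518 of stmt-CriticalPhenomena-4574

(`stub_shorteningStep` of line `kn_shortening_induction`, move `small_case+small_case`: `n ≤ 4` and
`A.card ≤ 2`).  Kozma–Nitzan shortening step `μ(⋃ a ∈ A, v ↔ a) · μ(a₀ ↔ b) ≤ μ(v ↔ b)` for the glued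
measure `μ = prodBernoulli (w[s(v,x) ↦ 1])` on at most four vertices.  Cases `b = v`, `a₀ = x`, `b = x`
as in the sibling V2374 (`s(v,x)` is `μ`-a.s. open); case `b = a₀`: the minimiser hypothesis forces
`μ(a ↔ a₀) = 1` for every relay `a ∈ A`; otherwise `v, x, a₀, b` exhaust `Fin n`, and either
`A ⊆ {a₀, b}` (Harris, `prodBernoulli_harris`) or `x ∈ A`, where `P_w(a₀ ↔ b) ≤ P_w(x ↔ b)` and three
one-bond decompositions (`stub_oneBondDecomp_k15`, along `s(x,a₀)` for `P_w` and for `μ`, then along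
`s(v,a₀)`) reduce `μ(a₀ ↔ b) ≤ μ(v ↔ b)` to a comparison of the two edge weights `w s(a₀,b) ≤ w s(x,b)`.
The hypothesis `A.card ≤ 2` and the induction hypothesis are not used.  No new definitions. -/

namespace Summit.CriticalPhenomena.PercolationContinuityZ3.Theorems

open MeasureTheory Set Literature.Probability.LatticeModels Literature.Probability.Percolation
open scoped Classical BigOperators

variable {n : ℕ}

/-- Two unordered pairs `s(p, q)` and `s(r, t)` are distinct as soon as `(p, q) ≠ (r, t)` and
`(p, q) ≠ (t, r)` componentwise (contrapositive of `Sym2.eq_iff`). -/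
theorem var2518_sym2_ne {α : Type*} {p q r t : α} (h1 : p ≠ r ∨ q ≠ t) (h2 : p ≠ t ∨ q ≠ r) :
    s(p, q) ≠ s(r, t) := by
  intro he
  rcases Sym2.eq_iff.1 he with ⟨rfl, rfl⟩ | ⟨rfl, rfl⟩
  · rcases h1 with h | h <;> exact h rfl
  · rcases h2 with h | h <;> exact h rfl

/-- A vertex all of whose pairs are closed in `ω` reaches only itself in `openGraph ω`. -/
theorem var2518_eq_of_reachable_of_isolated {V : Type*} (ω : BondConfig V) {z y : V}
    (h : ∀ u, u ≠ z → s(z, u) ∉ ω) (hr : (openGraph ω).Reachable z y) : y = z := by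
  obtain ⟨p⟩ := hr
  cases p with
  | nil => rfl
  | cons hadj _ =>
    rw [openGraph_adj] at hadj
    exact absurd hadj.1 (h _ (Ne.symm hadj.2))

/-- Transfer along an almost surely open pair: if `u e = 1` and `E ∩ {e open} ⊆ F` then
`P_u(E) ≤ P_u(F)`. -/
theorem var2518_transfer_open (u : Sym2 (Fin n) → unitInterval) (e : Sym2 (Fin n)) (he : u e = 1)
    {E F : Set (BondConfig (Fin n))} (hEF : ∀ ω ∈ E, e ∈ ω → ω ∈ F) :
    (prodBernoulli u).real E ≤ (prodBernoulli u).real F := by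
  have hnull : (prodBernoulli u).real {ω : BondConfig (Fin n) | e ∉ ω} = 0 := by
    rw [prodBernoulli_real_setOf_notMem, he]; simp
  have hsub : E ⊆ F ∪ {ω : BondConfig (Fin n) | e ∉ ω} := by
    intro ω hω
    by_cases h : e ∈ ω
    · exact Or.inl (hEF ω hω h)
    · exact Or.inr h
  calc (prodBernoulli u).real E
      ≤ (prodBernoulli u).real (F ∪ {ω : BondConfig (Fin n) | e ∉ ω}) := measureReal_mono hsub
    _ ≤ (prodBernoulli u).real F + (prodBernoulli u).real {ω : BondConfig (Fin n) | e ∉ ω} :=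
        measureReal_union_le _ _
    _ = (prodBernoulli u).real F := by rw [hnull, add_zero]

/-- Transfer along an almost surely closed pair: if `u e = 0` and `E ∩ {e closed} ⊆ F` then
`P_u(E) ≤ P_u(F)`. -/
theorem var2518_transfer_closed (u : Sym2 (Fin n) → unitInterval) (e : Sym2 (Fin n)) (he : u e = 0)
    {E F : Set (BondConfig (Fin n))} (hEF : ∀ ω ∈ E, e ∉ ω → ω ∈ F) :
    (prodBernoulli u).real E ≤ (prodBernoulli u).real F := by
  have hnull : (prodBernoulli u).real {ω : BondConfig (Fin n) | e ∈ ω} = 0 := by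
    rw [prodBernoulli_real_setOf_mem, he]; simp
  have hsub : E ⊆ F ∪ {ω : BondConfig (Fin n) | e ∈ ω} := by
    intro ω hω
    by_cases h : e ∈ ω
    · exact Or.inr h
    · exact Or.inl (hEF ω hω h)
  calc (prodBernoulli u).real E
      ≤ (prodBernoulli u).real (F ∪ {ω : BondConfig (Fin n) | e ∈ ω}) := measureReal_mono hsub
    _ ≤ (prodBernoulli u).real F + (prodBernoulli u).real {ω : BondConfig (Fin n) | e ∈ ω} :=
        measureReal_union_le _ _
    _ = (prodBernoulli u).real F := by rw [hnull, add_zero]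

/-- The weight of a pair of distinct vertices bounds the probability that they are connected:
`u s(y,z) = P_u(s(y,z) open) ≤ P_u(y ↔ z)`. -/
theorem var2518_weight_le_openConn (u : Sym2 (Fin n) → unitInterval) {y z : Fin n} (hyz : y ≠ z) :
    (u s(y, z) : ℝ) ≤ (prodBernoulli u).real (openConn y z) := by
  rw [← prodBernoulli_real_setOf_mem u s(y, z)]
  refine measureReal_mono ?_
  intro ω hω
  exact ((openGraph_adj ω y z).2 ⟨hω, hyz⟩).reachable

/-- **Extraction from the minimiser hypothesis.**  On the four vertices `v, x, a, b` with
`w s(v,x) = 0`: `P_w(a ↔ b) ≤ P_w(x ↔ b)` implies `(1 - w s(x,a)) · w s(a,b) ≤ (1 - w s(x,a)) · w s(x,b)`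
(one-bond decomposition along `s(x,a)`; on `{s(x,a) closed}`, `x` reaches `b` only through `s(x,b)`). -/
theorem var2518_hyp_extract (w : Sym2 (Fin n) → unitInterval) {v x a b : Fin n}
    (hvx : v ≠ x) (hva : v ≠ a) (hxa : x ≠ a) (hxb : x ≠ b) (hab : a ≠ b)
    (hall : ∀ z : Fin n, z = v ∨ z = x ∨ z = a ∨ z = b)
    (hw0 : w s(v, x) = 0)
    (hmin : (prodBernoulli w).real (openConn a b) ≤ (prodBernoulli w).real (openConn x b)) :
    (1 - (w s(x, a) : ℝ)) * (w s(a, b) : ℝ) ≤ (1 - (w s(x, a) : ℝ)) * (w s(x, b) : ℝ) := by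
  have hA := stub_oneBondDecomp_k15 n w s(x, a) (openConn a b)
  have hX := stub_oneBondDecomp_k15 n w s(x, a) (openConn x b)
  set w₀ := Function.update w s(x, a) 0 with hw₀def
  set w₁ := Function.update w s(x, a) 1 with hw₁def
  have e03 : s(v, x) ≠ s(x, a) := var2518_sym2_ne (Or.inl hvx) (Or.inl hva)
  have e53 : s(a, b) ≠ s(x, a) := var2518_sym2_ne (Or.inl hxa.symm) (Or.inr hxb.symm)
  have e43 : s(x, b) ≠ s(x, a) := var2518_sym2_ne (Or.inr hab.symm) (Or.inl hxa)
  have hw₀3 : w₀ s(x, a) = 0 := by rw [hw₀def, Function.update_self]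
  have hw₀0 : w₀ s(v, x) = 0 := by rw [hw₀def, Function.update_of_ne e03, hw0]
  have hw₀5 : w₀ s(a, b) = w s(a, b) := by rw [hw₀def, Function.update_of_ne e53]
  have hw₀4 : w₀ s(x, b) = w s(x, b) := by rw [hw₀def, Function.update_of_ne e43]
  have hw₁3 : w₁ s(x, a) = 1 := by rw [hw₁def, Function.update_self]
  -- open side: `{x ↔ b} ⊆ {a ↔ b}` almost surely under `w₁`
  have hF2 : (prodBernoulli w₁).real (openConn x b) ≤ (prodBernoulli w₁).real (openConn a b) :=
    var2518_transfer_open w₁ s(x, a) hw₁3 fun ω hω h3 =>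
      SimpleGraph.Reachable.trans
        ((openGraph_adj ω a x).2 ⟨by rw [Sym2.eq_swap]; exact h3, hxa.symm⟩).reachable hω
  -- closed side, lower bound: `w s(a,b) ≤ P_{w₀}(a ↔ b)`
  have hF3 : (w s(a, b) : ℝ) ≤ (prodBernoulli w₀).real (openConn a b) := by
    rw [← hw₀5]; exact var2518_weight_le_openConn w₀ hab
  -- closed side, upper bound: `P_{w₀}(x ↔ b) ≤ w s(x,b)` (otherwise `x` is isolated)
  have hF4 : (prodBernoulli w₀).real (openConn x b) ≤ w s(x, b) := by
    have h1 : (prodBernoulli w₀).real (openConn x b) ≤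
        (prodBernoulli w₀).real (openConn x b ∩ {ω | s(v, x) ∉ ω}) :=
      var2518_transfer_closed w₀ s(v, x) hw₀0 fun ω hω h => ⟨hω, h⟩
    have h2 : (prodBernoulli w₀).real (openConn x b ∩ {ω | s(v, x) ∉ ω}) ≤
        (prodBernoulli w₀).real {ω | s(x, b) ∈ ω} := by
      refine var2518_transfer_closed w₀ s(x, a) hw₀3 fun ω hω h3 => ?_
      by_contra h4
      have hiso : ∀ y, y ≠ x → s(x, y) ∉ ω := by
        intro y hy
        rcases hall y with rfl | rfl | rfl | rfl
        · rw [Sym2.eq_swap]; exact hω.2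
        · exact absurd rfl hy
        · exact h3
        · exact h4
      exact hxb (var2518_eq_of_reachable_of_isolated ω hiso hω.1).symm
    rw [← hw₀4, ← prodBernoulli_real_setOf_mem w₀ s(x, b)]
    exact h1.trans h2
  have p3nn : (0 : ℝ) ≤ w s(x, a) := (w s(x, a)).2.1
  have p3le : (w s(x, a) : ℝ) ≤ 1 := (w s(x, a)).2.2
  have c3nn : (0 : ℝ) ≤ 1 - w s(x, a) := sub_nonneg.2 p3le
  have k1 := mul_le_mul_of_nonneg_left hF2 p3nn
  have k2 := mul_le_mul_of_nonneg_left hF3 c3nn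
  have k3 := mul_le_mul_of_nonneg_left hF4 c3nn
  rw [hA, hX] at hmin
  linarith

/-- **Closed side of the glued comparison.**  For weights `u` on the four vertices `v, x, a, b`
with `s(v,x)` a.s. open and `s(x,a)` a.s. closed, `u s(a,b) ≤ u s(x,b)` implies `P_u(a ↔ b) ≤ P_u(v ↔ b)`
(one-bond decomposition along `s(v,a)`; on `{s(v,a) closed}`, `a` reaches `b` only through `s(a,b)`). -/
theorem var2518_closed_side (u : Sym2 (Fin n) → unitInterval) {v x a b : Fin n}
    (hvx : v ≠ x) (hva : v ≠ a) (hvb : v ≠ b) (hxa : x ≠ a) (hxb : x ≠ b) (hab : a ≠ b)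
    (hall : ∀ z : Fin n, z = v ∨ z = x ∨ z = a ∨ z = b)
    (hu0 : u s(v, x) = 1) (hu3 : u s(x, a) = 0)
    (h54 : (u s(a, b) : ℝ) ≤ u s(x, b)) :
    (prodBernoulli u).real (openConn a b) ≤ (prodBernoulli u).real (openConn v b) := by
  have hA := stub_oneBondDecomp_k15 n u s(v, a) (openConn a b)
  have hV := stub_oneBondDecomp_k15 n u s(v, a) (openConn v b)
  set u₀ := Function.update u s(v, a) 0 with hu₀def
  set u₁ := Function.update u s(v, a) 1 with hu₁def
  have e31 : s(x, a) ≠ s(v, a) := var2518_sym2_ne (Or.inl hvx.symm) (Or.inl hxa)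
  have e01 : s(v, x) ≠ s(v, a) := var2518_sym2_ne (Or.inr hxa) (Or.inl hva)
  have e51 : s(a, b) ≠ s(v, a) := var2518_sym2_ne (Or.inl hva.symm) (Or.inr hvb.symm)
  have e41 : s(x, b) ≠ s(v, a) := var2518_sym2_ne (Or.inl hvx.symm) (Or.inl hxa)
  have hu₀1 : u₀ s(v, a) = 0 := by rw [hu₀def, Function.update_self]
  have hu₀3 : u₀ s(x, a) = 0 := by rw [hu₀def, Function.update_of_ne e31, hu3]
  have hu₀0 : u₀ s(v, x) = 1 := by rw [hu₀def, Function.update_of_ne e01, hu0]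
  have hu₀5 : u₀ s(a, b) = u s(a, b) := by rw [hu₀def, Function.update_of_ne e51]
  have hu₀4 : u₀ s(x, b) = u s(x, b) := by rw [hu₀def, Function.update_of_ne e41]
  have hu₁1 : u₁ s(v, a) = 1 := by rw [hu₁def, Function.update_self]
  -- open side: `{a ↔ b} ⊆ {v ↔ b}` almost surely under `u₁`
  have hG4 : (prodBernoulli u₁).real (openConn a b) ≤ (prodBernoulli u₁).real (openConn v b) :=
    var2518_transfer_open u₁ s(v, a) hu₁1 fun ω hω h1 =>
      SimpleGraph.Reachable.trans ((openGraph_adj ω v a).2 ⟨h1, hva⟩).reachable hω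
  -- closed side, upper bound: `P_{u₀}(a ↔ b) ≤ u s(a,b)` (otherwise `a` is isolated)
  have hG5 : (prodBernoulli u₀).real (openConn a b) ≤ u s(a, b) := by
    have h1 : (prodBernoulli u₀).real (openConn a b) ≤
        (prodBernoulli u₀).real (openConn a b ∩ {ω | s(v, a) ∉ ω}) :=
      var2518_transfer_closed u₀ s(v, a) hu₀1 fun ω hω h => ⟨hω, h⟩
    have h2 : (prodBernoulli u₀).real (openConn a b ∩ {ω | s(v, a) ∉ ω}) ≤
        (prodBernoulli u₀).real {ω | s(a, b) ∈ ω} := by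
      refine var2518_transfer_closed u₀ s(x, a) hu₀3 fun ω hω h3 => ?_
      by_contra h5
      have hiso : ∀ y, y ≠ a → s(a, y) ∉ ω := by
        intro y hy
        rcases hall y with rfl | rfl | rfl | rfl
        · rw [Sym2.eq_swap]; exact hω.2
        · rw [Sym2.eq_swap]; exact h3
        · exact absurd rfl hy
        · exact h5
      exact hab (var2518_eq_of_reachable_of_isolated ω hiso hω.1).symm
    rw [← hu₀5, ← prodBernoulli_real_setOf_mem u₀ s(a, b)]
    exact h1.trans h2
  -- closed side, lower bound: `u s(x,b) ≤ P_{u₀}(v ↔ b)` (the path `v – x – b`)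
  have hG6 : (u s(x, b) : ℝ) ≤ (prodBernoulli u₀).real (openConn v b) := by
    rw [← hu₀4, ← prodBernoulli_real_setOf_mem u₀ s(x, b)]
    exact var2518_transfer_open u₀ s(v, x) hu₀0 fun ω h4 h0 =>
      SimpleGraph.Reachable.trans ((openGraph_adj ω v x).2 ⟨h0, hvx⟩).reachable
        ((openGraph_adj ω x b).2 ⟨h4, hxb⟩).reachable
  have p1nn : (0 : ℝ) ≤ u s(v, a) := (u s(v, a)).2.1
  have p1le : (u s(v, a) : ℝ) ≤ 1 := (u s(v, a)).2.2
  have hc : (1 - (u s(v, a) : ℝ)) * (prodBernoulli u₀).real (openConn a b) ≤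
      (1 - (u s(v, a) : ℝ)) * (prodBernoulli u₀).real (openConn v b) :=
    mul_le_mul_of_nonneg_left (hG5.trans (h54.trans hG6)) (sub_nonneg.2 p1le)
  have ho : (u s(v, a) : ℝ) * (prodBernoulli u₁).real (openConn a b) ≤
      (u s(v, a) : ℝ) * (prodBernoulli u₁).real (openConn v b) :=
    mul_le_mul_of_nonneg_left hG4 p1nn
  rw [hA, hV]
  exact add_le_add hc ho

/-- **Key comparison for the glued measure.**  On the four vertices `v, x, a, b` with `w s(v,x) = 0`,
`P_w(a ↔ b) ≤ P_w(x ↔ b)` implies `μ(a ↔ b) ≤ μ(v ↔ b)` for `μ = prodBernoulli (w[s(v,x) ↦ 1])` (one-bond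
decomposition of `μ` along `s(x,a)`; closed side `var2518_closed_side` fed by `var2518_hyp_extract`). -/
theorem var2518_key (w : Sym2 (Fin n) → unitInterval) {v x a b : Fin n}
    (hvx : v ≠ x) (hva : v ≠ a) (hvb : v ≠ b) (hxa : x ≠ a) (hxb : x ≠ b) (hab : a ≠ b)
    (hall : ∀ z : Fin n, z = v ∨ z = x ∨ z = a ∨ z = b)
    (hw0 : w s(v, x) = 0)
    (hmin : (prodBernoulli w).real (openConn a b) ≤ (prodBernoulli w).real (openConn x b)) :
    (prodBernoulli (Function.update w s(v, x) 1)).real (openConn a b) ≤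
      (prodBernoulli (Function.update w s(v, x) 1)).real (openConn v b) := by
  have h54 := var2518_hyp_extract w hvx hva hxa hxb hab hall hw0 hmin
  set wp := Function.update w s(v, x) 1 with hwpdef
  have hA := stub_oneBondDecomp_k15 n wp s(x, a) (openConn a b)
  have hV := stub_oneBondDecomp_k15 n wp s(x, a) (openConn v b)
  set u₀ := Function.update wp s(x, a) 0 with hu₀def
  set u₁ := Function.update wp s(x, a) 1 with hu₁def
  have e30 : s(x, a) ≠ s(v, x) := var2518_sym2_ne (Or.inl hvx.symm) (Or.inr hva.symm)
  have e03 : s(v, x) ≠ s(x, a) := e30.symm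
  have e50 : s(a, b) ≠ s(v, x) := var2518_sym2_ne (Or.inl hva.symm) (Or.inl hxa.symm)
  have e53 : s(a, b) ≠ s(x, a) := var2518_sym2_ne (Or.inl hxa.symm) (Or.inr hxb.symm)
  have e40 : s(x, b) ≠ s(v, x) := var2518_sym2_ne (Or.inl hvx.symm) (Or.inr hvb.symm)
  have e43 : s(x, b) ≠ s(x, a) := var2518_sym2_ne (Or.inr hab.symm) (Or.inl hxa)
  have hwp0 : wp s(v, x) = 1 := by rw [hwpdef, Function.update_self]
  have hwp3 : wp s(x, a) = w s(x, a) := by rw [hwpdef, Function.update_of_ne e30]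
  have hwp5 : wp s(a, b) = w s(a, b) := by rw [hwpdef, Function.update_of_ne e50]
  have hwp4 : wp s(x, b) = w s(x, b) := by rw [hwpdef, Function.update_of_ne e40]
  have hu₁0 : u₁ s(v, x) = 1 := by rw [hu₁def, Function.update_of_ne e03, hwp0]
  have hu₁3 : u₁ s(x, a) = 1 := by rw [hu₁def, Function.update_self]
  have hu₀0 : u₀ s(v, x) = 1 := by rw [hu₀def, Function.update_of_ne e03, hwp0]
  have hu₀3 : u₀ s(x, a) = 0 := by rw [hu₀def, Function.update_self]
  have hu₀5 : u₀ s(a, b) = w s(a, b) := by rw [hu₀def, Function.update_of_ne e53, hwp5]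
  have hu₀4 : u₀ s(x, b) = w s(x, b) := by rw [hu₀def, Function.update_of_ne e43, hwp4]
  -- open side: `{a ↔ b} ⊆ {v ↔ b}` almost surely under `u₁` (both `s(v,x)` and `s(x,a)` open)
  have hG2 : (prodBernoulli u₁).real (openConn a b) ≤ (prodBernoulli u₁).real (openConn v b) := by
    have h1 : (prodBernoulli u₁).real (openConn a b) ≤
        (prodBernoulli u₁).real (openConn a b ∩ {ω | s(v, x) ∈ ω}) :=
      var2518_transfer_open u₁ s(v, x) hu₁0 fun ω hω h => ⟨hω, h⟩
    refine h1.trans (var2518_transfer_open u₁ s(x, a) hu₁3 fun ω hω h3 => ?_)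
    have hvx' : (openGraph ω).Reachable v x := ((openGraph_adj ω v x).2 ⟨hω.2, hvx⟩).reachable
    have hxa' : (openGraph ω).Reachable x a := ((openGraph_adj ω x a).2 ⟨h3, hxa⟩).reachable
    exact (hvx'.trans hxa').trans hω.1
  have p3nn : (0 : ℝ) ≤ w s(x, a) := (w s(x, a)).2.1
  have p3le : (w s(x, a) : ℝ) ≤ 1 := (w s(x, a)).2.2
  rw [hA, hV, hwp3]
  have ho := mul_le_mul_of_nonneg_left hG2 p3nn
  rcases p3le.lt_or_eq with hlt | heq
  · -- closed side via `var2518_closed_side`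
    have hpos : (0 : ℝ) < 1 - w s(x, a) := sub_pos.2 hlt
    have h54' : (w s(a, b) : ℝ) ≤ w s(x, b) := le_of_mul_le_mul_left h54 hpos
    have hG3 : (prodBernoulli u₀).real (openConn a b) ≤ (prodBernoulli u₀).real (openConn v b) :=
      var2518_closed_side u₀ hvx hva hvb hxa hxb hab hall hu₀0 hu₀3
        (by rw [hu₀5, hu₀4]; exact h54')
    have hc := mul_le_mul_of_nonneg_left hG3 hpos.le
    exact add_le_add hc ho
  · rw [heq] at ho ⊢
    linarith

/-- TTRL-lite variant V2518 of `stub_shorteningStep` (stmt-CriticalPhenomena-4574, Kozma–Nitzan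
Conjecture 6 with the induction hypothesis displayed): the shortening step
`μ(⋃ a ∈ A, v ↔ a) · μ(a₀ ↔ b) ≤ μ(v ↔ b)` for the glued measure `μ = prodBernoulli (w[s(v,x) ↦ 1])`
in the small case `n ≤ 4`, `A.card ≤ 2`.  Cases `b ∈ {v, x}` or `a₀ = x`: `s(v,x)` is `μ`-a.s. open;
case `b = a₀`: every relay is `μ`-a.s. connected to `a₀` by the minimiser hypothesis; otherwise
`v, x, a₀, b` exhaust `Fin n` and either `A ⊆ {a₀, b}` (Harris) or `x ∈ A` (`var2518_key`). -/
theorem stub_shorteningStep_var2518 : ∀ (n : ℕ) (w : Sym2 (Fin n) → unitInterval) (A : Finset (Fin n)) (b v x a₀ : Fin n), n ≤ 4 → A.card ≤ 2 → v ∉ A → v ≠ x → w s(v, x) = 0 → a₀ ∈ A → (∀ a ∈ A, (prodBernoulli w).real (openConn a₀ b) ≤ (prodBernoulli w).real (openConn a b)) → (∀ w' : Sym2 (Fin n) → unitInterval, (∀ e, w e = 0 → w' e = 0) → ∀ (A' : Finset (Fin n)) (o' b' : Fin n) (t : ℝ), (∀ a ∈ A', t ≤ (prodBernoulli w').real (openConn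 a b')) → (prodBernoulli w').real (⋃ a ∈ A', openConn o' a) * t ≤ (prodBernoulli w').real (openConn o' b')) → (prodBernoulli (Function.update w s(v, x) 1)).real (⋃ a ∈ A, openConn v a) * (prodBernoulli (Function.update w s(v, x) 1)).real (openConn a₀ b) ≤ (prodBernoulli (Function.update w s(v, x) 1)).real (openConn v b) := by
  intro n w A b v x a₀ hn _hcard hvA hvx hw0 ha₀ hmin _hIH
  -- the product of the two factors is at most each factor, and at most `1`
  have hLY : (prodBernoulli (Function.update w s(v, x) 1)).real (⋃ a ∈ A, openConn v a) *
      (prodBernoulli (Function.update w s(v, x) 1)).real (openConn a₀ b) ≤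
      (prodBernoulli (Function.update w s(v, x) 1)).real (⋃ a ∈ A, openConn v a) :=
    mul_le_of_le_one_right measureReal_nonneg measureReal_le_one
  have hLZ : (prodBernoulli (Function.update w s(v, x) 1)).real (⋃ a ∈ A, openConn v a) *
      (prodBernoulli (Function.update w s(v, x) 1)).real (openConn a₀ b) ≤
      (prodBernoulli (Function.update w s(v, x) 1)).real (openConn a₀ b) :=
    mul_le_of_le_one_left measureReal_nonneg measureReal_le_one
  have hL1 : (prodBernoulli (Function.update w s(v, x) 1)).real (⋃ a ∈ A, openConn v a) *
      (prodBernoulli (Function.update w s(v, x) 1)).real (openConn a₀ b) ≤ 1 :=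
    hLY.trans measureReal_le_one
  have hwp0 : Function.update w s(v, x) 1 s(v, x) = 1 := by rw [Function.update_self]
  have hF1 : ∀ z : Fin n, (prodBernoulli (Function.update w s(v, x) 1)).real (openConn x z) ≤
      (prodBernoulli (Function.update w s(v, x) 1)).real (openConn v z) := fun z =>
    var2518_transfer_open _ s(v, x) hwp0 fun ω hω h =>
      SimpleGraph.Reachable.trans ((openGraph_adj ω v x).2 ⟨h, hvx⟩).reachable hω
  have hrefl : ∀ (p : Sym2 (Fin n) → unitInterval) (z : Fin n),
      (prodBernoulli p).real (openConn z z) = 1 := by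
    intro p z
    have : (openConn z z : Set (BondConfig (Fin n))) = Set.univ := by
      ext ω; exact ⟨fun _ => trivial, fun _ => SimpleGraph.Reachable.refl z⟩
    rw [this]; exact probReal_univ
  by_cases hbv : b = v
  · subst hbv
    rw [hrefl]; exact hL1
  by_cases ha₀x : a₀ = x
  · subst ha₀x
    exact hLZ.trans (hF1 b)
  have ha₀v : a₀ ≠ v := fun h => hvA (h ▸ ha₀)
  by_cases hbx : b = x
  · subst hbx
    have h1 : 1 ≤ (prodBernoulli (Function.update w s(v, b) 1)).real (openConn v b) := by
      have := hF1 b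
      rwa [hrefl] at this
    exact hL1.trans h1
  -- monotonicity in the weights: `P_w ≤ μ` on increasing events
  have hle : w ≤ Function.update w s(v, x) 1 := by
    intro e
    by_cases he : e = s(v, x)
    · subst he; rw [Function.update_self]; exact unitInterval.le_one _
    · rw [Function.update_of_ne he]
  -- case `b = a₀`: every relay is a.s. connected to `a₀`
  by_cases hba : b = a₀
  · subst hba
    rw [hrefl, mul_one]
    have hT : ∀ a ∈ A, 1 ≤ (prodBernoulli (Function.update w s(v, x) 1)).real (openConn a b) := by
      intro a ha
      have hm := hmin a ha
      rw [hrefl] at hm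
      exact hm.trans (prodBernoulli_real_mono_of_isUpperSet hle (isUpperSet_openConn a b)
        (Set.toFinite _).measurableSet)
    have hsub : (⋃ a ∈ A, openConn v a : Set (BondConfig (Fin n))) ⊆
        openConn v b ∪ ⋃ a ∈ A, (openConn a b)ᶜ := by
      intro ω hω
      simp only [mem_iUnion, exists_prop] at hω
      obtain ⟨a, ha, hva⟩ := hω
      by_cases hab : ω ∈ openConn a b
      · exact Or.inl (SimpleGraph.Reachable.trans hva hab)
      · exact Or.inr (mem_iUnion₂.2 ⟨a, ha, hab⟩)
    have h0 : ∀ a ∈ A, (prodBernoulli (Function.update w s(v, x) 1)).real (openConn a b)ᶜ = 0 := by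
      intro a ha
      rw [measureReal_compl (Set.toFinite _).measurableSet, probReal_univ]
      have h2 := hT a ha
      have h3 : (prodBernoulli (Function.update w s(v, x) 1)).real (openConn a b) ≤ 1 :=
        measureReal_le_one
      linarith
    calc (prodBernoulli (Function.update w s(v, x) 1)).real (⋃ a ∈ A, openConn v a)
        ≤ (prodBernoulli (Function.update w s(v, x) 1)).real
            (openConn v b ∪ ⋃ a ∈ A, (openConn a b)ᶜ) := measureReal_mono hsub
      _ ≤ (prodBernoulli (Function.update w s(v, x) 1)).real (openConn v b) +
            (prodBernoulli (Function.update w s(v, x) 1)).real (⋃ a ∈ A, (openConn a b)ᶜ) :=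
          measureReal_union_le _ _
      _ ≤ (prodBernoulli (Function.update w s(v, x) 1)).real (openConn v b) +
            ∑ a ∈ A, (prodBernoulli (Function.update w s(v, x) 1)).real (openConn a b)ᶜ := by
          gcongr
          exact measureReal_biUnion_finset_le _ _
      _ = (prodBernoulli (Function.update w s(v, x) 1)).real (openConn v b) := by
          rw [Finset.sum_eq_zero h0, add_zero]
  -- now `v, x, a₀, b` are pairwise distinct, hence exhaust `Fin n` (`n ≤ 4`)
  have hall : ∀ z : Fin n, z = v ∨ z = x ∨ z = a₀ ∨ z = b := by
    intro z
    by_contra hz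
    simp only [not_or] at hz
    obtain ⟨hzv, hzx, hza, hzb⟩ := hz
    have h2 : ({a₀, b} : Finset (Fin n)).card = 2 := Finset.card_pair (fun h => hba h.symm)
    have h3 : x ∉ ({a₀, b} : Finset (Fin n)) := by
      simp only [Finset.mem_insert, Finset.mem_singleton, not_or]; exact ⟨Ne.symm ha₀x, Ne.symm hbx⟩
    have h4 : v ∉ ({x, a₀, b} : Finset (Fin n)) := by
      simp only [Finset.mem_insert, Finset.mem_singleton, not_or]; exact ⟨hvx, ha₀v.symm, Ne.symm hbv⟩
    have h5 : z ∉ ({v, x, a₀, b} : Finset (Fin n)) := by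
      simp only [Finset.mem_insert, Finset.mem_singleton, not_or]; exact ⟨hzv, hzx, hza, hzb⟩
    have hcard : ({z, v, x, a₀, b} : Finset (Fin n)).card ≤ n := by
      calc ({z, v, x, a₀, b} : Finset (Fin n)).card ≤ Fintype.card (Fin n) := Finset.card_le_univ _
        _ = n := Fintype.card_fin n
    rw [Finset.card_insert_of_notMem h5, Finset.card_insert_of_notMem h4,
      Finset.card_insert_of_notMem h3, h2] at hcard
    omega
  by_cases hxA : x ∈ A
  · -- `x ∈ A`: the minimiser hypothesis at `x` and the key comparison
    exact hLZ.trans (var2518_key w hvx (Ne.symm ha₀v) (Ne.symm hbv) (Ne.symm ha₀x) (Ne.symm hbx)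
      (Ne.symm hba) hall hw0 (hmin x hxA))
  · -- `x ∉ A`: `A ⊆ {a₀, b}` and Harris' inequality
    have hAsub : ∀ a ∈ A, a = a₀ ∨ a = b := by
      intro a ha
      rcases hall a with h | h | h | h
      · exact absurd (h ▸ ha) hvA
      · exact absurd (h ▸ ha) hxA
      · exact Or.inl h
      · exact Or.inr h
    have hU : IsUpperSet (⋃ a ∈ A, openConn v a : Set (BondConfig (Fin n))) :=
      isUpperSet_iUnion₂ fun a _ => isUpperSet_openConn v a
    have hH := prodBernoulli_harris (Function.update w s(v, x) 1) hU (isUpperSet_openConn a₀ b)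
      (Set.toFinite _).measurableSet (Set.toFinite _).measurableSet
    refine hH.trans (measureReal_mono ?_)
    rintro ω ⟨hωU, hωab⟩
    simp only [mem_iUnion, exists_prop] at hωU
    obtain ⟨a, ha, hva⟩ := hωU
    rcases hAsub a ha with rfl | rfl
    · exact SimpleGraph.Reachable.trans hva hωab
    · exact hva

end Summit.CriticalPhenomena.PercolationContinuityZ3.Theorems
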